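import Summits.BirchSwinnertonDyer.BirchSwinnertonDyer.Theorems.ManinLocalTwoThreeMazurManinConstantOddPrimes
import Summits.BirchSwinnertonDyer.BirchSwinnertonDyer.Theses.SignedLowerHalves
import Literature.NumberTheory.EllipticCurves.SkinnerUrban2014.PAdicUnitPeriodRatioProofs
import HarnessLib

set_option autoImplicit false
-- the sub-problem namespace `Summit.BirchSwinnertonDyer.BirchSwinnertonDyer` duplicates a component by design (D-0017)
set_option linter.dupNamespace false

/-!
# The Greenberg–Vatsal period comparison `Ω(W) = u · Ω⁺_f`, `|u|_p = 1`, as tree theorems; support items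
# `RealPeriodUnitPlusPeriod` (stmt-BirchSwinnertonDyer-19290) and `RealPeriodUnitPlusPeriodThree`
# (stmt-BirchSwinnertonDyer-19291) closed by name

Three statement-only (cite-only) Literature facts of `ModularCurvePeriodRatio.lean` [GreenbergVatsal2000, §3, Remark 3.4]:
for a globally minimal elliptic `W/ℚ` with `E[p]` irreducible and the newform `f` of `W`, `Ω(W) = u · Ω⁺_f` with `u ∈ ℚ` a
`p`-adic unit —

* `realPeriodRat_eq_unit_mul_plusPeriod` (good `p ≥ 5`),
* `realPeriodRat_eq_unit_mul_plusPeriod_three` (good `p = 3`),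
* `realPeriodRat_eq_unit_mul_plusPeriod_of_multiplicative` (multiplicative `p ≥ 5`).

`SkinnerUrban2014/PAdicUnitPeriodRatioProofs.lean` proved all three from the single named fact
`mazur_not_dvd_maninConstant_of_odd` (Mazur 1978 Cor. 4.1, lattice rendering: `…_of_mazur`), and that fact is now the tree
theorem `mazur_not_dvd_maninConstant_of_odd_holds` (Stevens' inclusion ⟸ the Unbounded Denominators theorem
[CalegariDimitrovTang2025, Thm. 1.0.1], tree theorem `calegariDimitrovTang2025_unboundedDenominators_holds`, and the
conjugation obstruction).  This file discharges the three facts (`…_holds`), the inline period-unit binder `hϖ` of the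
rank-`0` leading-term theorems, and closes the two shared support items BY NAME through route SignedLowerHalves'
declarations (19290 is shared by nine routes, 19291 by six).

HONEST STATUS.  BSD is not proved by this; no rung or class is closed by this file alone; the statement audit of the
vendored definitions under these kernel terms (period lattices, Manin constant, the CDT statement) is pending.
[cite: GreenbergVatsal2000, §3, Remark 3.4] [cite: Mazur1978, Cor. 4.1] [cite: CalegariDimitrovTang2025, Thm. 1.0.1]
[cite: SkinnerUrban2014, §3.6.7]
-/

noncomputable section

open scoped MatrixGroups ModularForm
open WeierstrassCurve CongruenceSubgroup
open Literature.NumberTheory.EllipticCurves Literature.NumberTheory.EllipticCurves.ModularForms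
open Literature.NumberTheory.EllipticCurves.SkinnerUrban2014

namespace Summit.BirchSwinnertonDyer.BirchSwinnertonDyer.Theorems

/-- **Greenberg–Vatsal 2000, Remark 3.4 at good `p ≥ 5` holds** (the Literature named fact
`realPeriodRat_eq_unit_mul_plusPeriod`): `Ω(W) = u · Ω⁺_f` with `|u|_p = 1` for globally minimal `W`, good `p ≥ 5`,
`E[p]` irreducible.  From Mazur's Cor. 4.1 as a tree theorem. [cite: GreenbergVatsal2000, §3, Remark 3.4] [cite: Mazur1978, Cor. 4.1] -/
theorem realPeriodRat_eq_unit_mul_plusPeriod_holds : realPeriodRat_eq_unit_mul_plusPeriod :=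
  realPeriodRat_eq_unit_mul_plusPeriod_of_mazur mazur_not_dvd_maninConstant_of_odd_holds

/-- **Greenberg–Vatsal 2000, Remark 3.4 at good `p = 3` holds** (the Literature named fact
`realPeriodRat_eq_unit_mul_plusPeriod_three`). [cite: GreenbergVatsal2000, §3, Remark 3.4] [cite: Mazur1978, Cor. 4.1] -/
theorem realPeriodRat_eq_unit_mul_plusPeriod_three_holds : realPeriodRat_eq_unit_mul_plusPeriod_three :=
  realPeriodRat_eq_unit_mul_plusPeriod_three_of_mazur mazur_not_dvd_maninConstant_of_odd_holds

/-- **Greenberg–Vatsal 2000, Remark 3.4 at multiplicative `p ≥ 5` holds** (the Literature named fact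
`realPeriodRat_eq_unit_mul_plusPeriod_of_multiplicative`). [cite: GreenbergVatsal2000, §3, Remark 3.4] [cite: Mazur1978, Cor. 4.1] -/
theorem realPeriodRat_eq_unit_mul_plusPeriod_of_multiplicative_holds :
    realPeriodRat_eq_unit_mul_plusPeriod_of_multiplicative :=
  realPeriodRat_eq_unit_mul_plusPeriod_of_multiplicative_of_mazur mazur_not_dvd_maninConstant_of_odd_holds

/-- **The inline period-unit binder `hϖ` of the rank-`0` leading-term theorems, unconditionally**: at every odd good
prime `p` with `E[p]` irreducible and every `ϖ ∈ ℚ` with `ϖ · Ω(W) = Ω⁺_f` (newform at level `N_W`), `ord_p ϖ = 0`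
(`SkinnerUrban2014.periodUnit_of_mazur` on the Mazur tree theorem). [cite: GreenbergVatsal2000, §3, Remark 3.4] [cite: Mazur1978, Cor. 4.1] -/
theorem periodUnit_of_good_of_irreducible :
    ∀ (W : WeierstrassCurve ℚ) [W.IsElliptic] [W.IsGloballyMinimal] (p : ℕ) [Fact p.Prime],
      p ≠ 2 → W.HasGoodReductionAtPrime p → W.HasIrreducibleModPGaloisRep p →
      ∀ [NeZero (W.conductorNorm ℤ)] (f : CuspForm (Gamma0 (W.conductorNorm ℤ)) 2),
        IsNewformOf W f →
      ∀ ϖ : ℚ, (ϖ : ℝ) * W.realPeriodRat = plusPeriod f → padicValRat p ϖ = 0 :=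
  periodUnit_of_mazur mazur_not_dvd_maninConstant_of_odd_holds

/-- **Support item `RealPeriodUnitPlusPeriod` (stmt-BirchSwinnertonDyer-19290), proved by name** through route
SignedLowerHalves' declaration (shared verbatim by nine BSD routes).  BSD is NOT proved by this.
[cite: GreenbergVatsal2000, §3, Remark 3.4] [cite: Mazur1978, Cor. 4.1] [cite: CalegariDimitrovTang2025, Thm. 1.0.1] -/
theorem SignedLowerHalves.RealPeriodUnitPlusPeriod_proof :
    Summit.BirchSwinnertonDyer.BirchSwinnertonDyer.Theses.SignedLowerHalves.RealPeriodUnitPlusPeriod :=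
  realPeriodRat_eq_unit_mul_plusPeriod_holds

/-- **Support item `RealPeriodUnitPlusPeriodThree` (stmt-BirchSwinnertonDyer-19291), proved by name** through route
SignedLowerHalves' declaration (shared verbatim by six BSD routes).  BSD is NOT proved by this.
[cite: GreenbergVatsal2000, §3, Remark 3.4] [cite: Mazur1978, Cor. 4.1] [cite: CalegariDimitrovTang2025, Thm. 1.0.1] -/
theorem SignedLowerHalves.RealPeriodUnitPlusPeriodThree_proof :
    Summit.BirchSwinnertonDyer.BirchSwinnertonDyer.Theses.SignedLowerHalves.RealPeriodUnitPlusPeriodThree :=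
  realPeriodRat_eq_unit_mul_plusPeriod_three_holds

end Summit.BirchSwinnertonDyer.BirchSwinnertonDyer.Theorems

end
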